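import Summits.Ventures.Crystal3D.Theorems.StickyWulffConstantGenericWallFloorRiserEndCover
import HarnessLib

/-!
# Riser-end rows R-G2H in the kernel, I: the glue `coverCheck ⇒ ContactsAtMost` and the minimal-obstacle rows
# `RiserEnd_E1_twoMin`, `RiserEnd_E2_twoMin`, `RiserEnd_E4_twoMin` (crux `GenericWallFloor`, stmt-Ventures-19480; cf-p2 R41v)

HONEST FRAMING. Venture `Summits/Ventures/Crystal3D` (cell `crystal3d-full`), helper `--supports` the crux
`GenericWallFloor` of `route-Ventures-StickyWulffConstant` (line `WallLedgerG`; 19480-p1 g6's `…RiserEndRows`).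
Rung credit only; F-C1 not moved.  Pure theorems, standard axioms.

* `contactsAtMost_of_cover` — if the unit sphere is covered by the open unit balls around `hcpPt '' F` and at most
  `k` members of `F` have `|P|² = 18`, then `ContactsAtMost 0 (F.image hcpPt) k` (in a `1`-separated configuration
  containing `hcpPt '' F` every contact of the centre is one of those `k` points);
* `contactsAtMost_of_coverCheck` — the same from a passing certificate of `…RiserEndCover`'s checker;
* the rows, each ONE application of `contactsAtMost_of_coverCheck` to the obstacle list (= the members of `F`, order
  as in the certificate), with the list-inclusion, the count and `coverCheck … = true` discharged by `decide +kernel`;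
  the six face trees were found by the exact integer branch-and-bound `calc/r41v/spherecover.py` (wulff-p2 g11) — the
  search is untrusted, only the kernel evaluation matters:
  `RiserEnd_E1_twoMin_holds` (51 leaves, depth ≤ 5);
  `RiserEnd_E2_twoMin_holds` (71 leaves, depth ≤ 7);
  `RiserEnd_E4_twoMin_holds` (55 leaves, depth ≤ 5);
WHAT THIS IS NOT: the one-sided rows `RiserEnd_E?_one` (isolated uncovered hole sites); no wall law; no statement
about which configurations realise these ends; F-C1 not moved.
-/

noncomputable section

namespace Summit.Ventures.Crystal3D.Theorems

open Finset Literature.Geometry.DiscreteGeometry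

/-! ### From a covered sphere to the row -/

/-- `‖hcpPt P‖ = 1` forces `|P|² = 18`. -/
theorem dotZ_eq_eighteen_of_norm_hcpPt {P : Fin 3 → ℤ} (h : ‖hcpPt P‖ = 1) : dotZ P P = 18 := by
  have h2 := norm_hcpPt_sq P
  rw [h, one_pow] at h2
  have : (dotZ P P : ℝ) = 18 := by linarith
  exact_mod_cast this

/-- **Glue**: if the unit sphere is covered by the open unit balls around `hcpPt '' F` and at most `k` points of
`F` lie ON the unit sphere, then `ContactsAtMost 0 (F.image hcpPt) k` — in a `1`-separated configuration containing
`hcpPt '' F` every contact of the centre is one of those `k` points. -/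
theorem contactsAtMost_of_cover (F : Finset (Fin 3 → ℤ)) (k : ℕ)
    (hk : (F.filter fun P => dotZ P P = 18).card ≤ k)
    (hcov : ∀ y : EuclideanSpace ℝ (Fin 3), ‖y‖ = 1 → ∃ P ∈ F, dist y (hcpPt P) < 1) :
    ContactsAtMost 0 (F.image hcpPt) k := by
  classical
  intro X hX hFX
  have hsub : (X.filter fun q => dist (0 : EuclideanSpace ℝ (Fin 3)) q = 1) ⊆
      (F.filter fun P => dotZ P P = 18).image hcpPt := by
    intro q hq
    obtain ⟨hqX, hd⟩ := Finset.mem_filter.1 hq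
    have hq1 : ‖q‖ = 1 := by rwa [dist_eq_norm, zero_sub, norm_neg] at hd
    obtain ⟨P, hPF, hPd⟩ := hcov q hq1
    have hPX : hcpPt P ∈ X := hFX (Finset.mem_image.2 ⟨P, hPF, rfl⟩)
    have hEq : q = hcpPt P := by
      by_contra hne
      have := hX q hqX (hcpPt P) hPX hne
      linarith
    refine Finset.mem_image.2 ⟨P, Finset.mem_filter.2 ⟨hPF, dotZ_eq_eighteen_of_norm_hcpPt ?_⟩, hEq.symm⟩
    rw [← hEq]; exact hq1
  calc (X.filter fun q => dist (0 : EuclideanSpace ℝ (Fin 3)) q = 1).card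
      ≤ ((F.filter fun P => dotZ P P = 18).image hcpPt).card := Finset.card_le_card hsub
    _ ≤ (F.filter fun P => dotZ P P = 18).card := Finset.card_image_le
    _ ≤ k := hk

/-- **Glue with the checker**: a passing certificate over an obstacle LIST contained in `F` proves the row. -/
theorem contactsAtMost_of_coverCheck (F : Finset (Fin 3 → ℤ)) (k : ℕ) (L : List (Fin 3 → ℤ))
    (hL : ∀ P ∈ L, P ∈ F) (hk : (F.filter fun P => dotZ P P = 18).card ≤ k)
    {t0p t0m t1p t1m t2p t2m : CoverTree} (h : coverCheck L t0p t0m t1p t1m t2p t2m = true) :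
    ContactsAtMost 0 (F.image hcpPt) k :=
  contactsAtMost_of_cover F k hk fun y hy =>
    let ⟨P, hP, hd⟩ := sphere_covered_of_coverCheck h y hy
    ⟨P, hL P hP, hd⟩

/-! ### The rows -/

/-- **Row `RiserEnd_E1_twoMin` HOLDS** (kernel theorem, standard axioms): `riserEnd_E1_own ∪ riserEnd_E1_killers` present ⇒ the centre has at
most `10` contacts.  Certificate: 51 leaves (faces 0p 7, 0m 10, 1p 7, 1m 10, 2p 10, 2m 7), max depth 5. -/
theorem RiserEnd_E1_twoMin_holds : RiserEnd_E1_twoMin :=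
  contactsAtMost_of_coverCheck (riserEnd_E1_own ∪ riserEnd_E1_killers) 10
    [![-4, -1, -1], ![-3, 3, 0], ![-1, -4, -1], ![-1, -1, -4], ![0, 3, -3], ![1, 1, 4], ![1, 4, 1], ![3, -3,
    0], ![3, 0, -3], ![4, 1, 1], ![-4, -1, 5], ![-1, -4, 5]]
    (by decide +kernel) (by decide +kernel)
    (t0p := .splitA (.splitB (.splitA (.leaf 7) (.leaf 8)) (.splitA (.leaf 7) (.leaf 9))) (.splitB (.splitA
    (.leaf 8) (.leaf 9)) (.leaf 9)))
    (t0m := .splitA (.splitB (.leaf 0) (.splitA (.leaf 0) (.splitB (.leaf 0) (.leaf 10)))) (.splitB (.splitA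
    (.leaf 0) (.leaf 1)) (.splitA (.splitB (.leaf 0) (.splitA (.leaf 10) (.leaf 1))) (.leaf 1))))
    (t1p := .splitA (.splitB (.splitA (.leaf 1) (.leaf 4)) (.splitA (.leaf 1) (.leaf 6))) (.splitB (.splitA
    (.leaf 4) (.leaf 6)) (.leaf 6)))
    (t1m := .splitA (.splitB (.leaf 2) (.splitA (.leaf 2) (.splitB (.leaf 2) (.leaf 11)))) (.splitB (.splitA
    (.leaf 2) (.leaf 7)) (.splitA (.splitB (.leaf 2) (.splitA (.leaf 11) (.leaf 7))) (.leaf 7))))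
    (t2p := .splitA (.splitB (.splitA (.leaf 10) (.splitB (.leaf 11) (.leaf 5))) (.splitA (.splitB (.leaf 10)
    (.leaf 1)) (.leaf 5))) (.splitB (.splitA (.splitB (.leaf 11) (.leaf 5)) (.leaf 5)) (.leaf 5)))
    (t2m := .splitA (.splitB (.leaf 3) (.splitA (.leaf 3) (.leaf 4))) (.splitB (.splitA (.leaf 3) (.leaf 8))
    (.splitA (.leaf 4) (.leaf 8))))
    (by decide +kernel)

/-- **Row `RiserEnd_E2_twoMin` HOLDS** (kernel theorem, standard axioms): `riserEnd_E2_own ∪ riserEnd_E2_killers` present ⇒ the centre has at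
most `8` contacts.  Certificate: 71 leaves (faces 0p 7, 0m 13, 1p 7, 1m 13, 2p 24, 2m 7), max depth 7. -/
theorem RiserEnd_E2_twoMin_holds : RiserEnd_E2_twoMin :=
  contactsAtMost_of_coverCheck (riserEnd_E2_own ∪ riserEnd_E2_killers) 8
    [![-3, 3, 0], ![-1, -1, -4], ![0, 3, -3], ![1, 1, 4], ![1, 4, 1], ![3, -3, 0], ![3, 0, -3], ![4, 1, 1],
    ![-5, -2, 1], ![-2, -5, 1]]
    (by decide +kernel) (by decide +kernel)
    (t0p := .splitA (.splitB (.splitA (.leaf 5) (.leaf 6)) (.splitA (.leaf 5) (.leaf 7))) (.splitB (.splitA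
    (.leaf 6) (.leaf 7)) (.leaf 7)))
    (t0m := .splitA (.splitB (.splitA (.splitB (.leaf 1) (.leaf 8)) (.splitB (.leaf 1) (.leaf 8))) (.leaf 8))
    (.splitB (.splitA (.splitB (.splitA (.leaf 1) (.leaf 0)) (.leaf 0)) (.leaf 0)) (.splitA (.splitB (.leaf 0)
    (.splitA (.leaf 8) (.leaf 0))) (.leaf 0))))
    (t1p := .splitA (.splitB (.splitA (.leaf 0) (.leaf 2)) (.splitA (.leaf 0) (.leaf 4))) (.splitB (.splitA
    (.leaf 2) (.leaf 4)) (.leaf 4)))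
    (t1m := .splitA (.splitB (.splitA (.splitB (.leaf 1) (.leaf 9)) (.splitB (.leaf 1) (.leaf 9))) (.leaf 9))
    (.splitB (.splitA (.splitB (.splitA (.leaf 1) (.leaf 5)) (.leaf 5)) (.leaf 5)) (.splitA (.splitB (.leaf 5)
    (.splitA (.leaf 9) (.leaf 5))) (.leaf 5))))
    (t2p := .splitA (.splitB (.splitA (.splitB (.leaf 8) (.splitA (.leaf 8) (.splitB (.splitA (.leaf 8) (.leaf
    3)) (.leaf 3)))) (.splitB (.splitA (.splitB (.leaf 9) (.splitA (.leaf 9) (.leaf 3))) (.splitB (.leaf 9)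
    (.leaf 3))) (.leaf 3))) (.splitA (.splitB (.splitA (.splitB (.splitA (.leaf 8) (.leaf 3)) (.leaf 0)) (.leaf
    3)) (.leaf 0)) (.leaf 3))) (.splitB (.splitA (.splitB (.splitA (.splitB (.splitA (.leaf 9) (.leaf 3))
    (.leaf 3)) (.leaf 3)) (.leaf 3)) (.leaf 3)) (.leaf 3)))
    (t2m := .splitA (.splitB (.leaf 1) (.splitA (.leaf 1) (.leaf 2))) (.splitB (.splitA (.leaf 1) (.leaf 6))
    (.splitA (.leaf 2) (.leaf 6))))
    (by decide +kernel)

/-- **Row `RiserEnd_E4_twoMin` HOLDS** (kernel theorem, standard axioms): `riserEnd_E4_own ∪ riserEnd_E4_killers` present ⇒ the centre has at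
most `10` contacts.  Certificate: 55 leaves (faces 0p 11, 0m 8, 1p 11, 1m 8, 2p 8, 2m 9), max depth 5. -/
theorem RiserEnd_E4_twoMin_holds : RiserEnd_E4_twoMin :=
  contactsAtMost_of_coverCheck (riserEnd_E4_own ∪ riserEnd_E4_killers) 10
    [![-3, -3, 0], ![-3, 0, -3], ![-3, 0, 3], ![-3, 3, 0], ![0, -3, -3], ![0, -3, 3], ![0, 3, 3], ![3, -3, 0],
    ![3, 0, 3], ![3, 3, 0], ![2, 2, -4]]
    (by decide +kernel) (by decide +kernel)
    (t0p := .splitA (.splitB (.splitA (.leaf 7) (.splitB (.splitA (.leaf 7) (.leaf 10)) (.leaf 7))) (.splitA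
    (.leaf 7) (.leaf 8))) (.splitB (.splitA (.splitB (.leaf 10) (.leaf 9)) (.leaf 9)) (.splitA (.leaf 8) (.leaf
    9))))
    (t0m := .splitA (.splitB (.splitA (.leaf 0) (.leaf 1)) (.splitA (.leaf 0) (.leaf 2))) (.splitB (.splitA
    (.leaf 1) (.leaf 3)) (.splitA (.leaf 2) (.leaf 3))))
    (t1p := .splitA (.splitB (.splitA (.leaf 3) (.splitB (.splitA (.leaf 3) (.leaf 10)) (.leaf 3))) (.splitA
    (.leaf 3) (.leaf 6))) (.splitB (.splitA (.splitB (.leaf 10) (.leaf 9)) (.leaf 9)) (.splitA (.leaf 6) (.leaf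
    9))))
    (t1m := .splitA (.splitB (.splitA (.leaf 0) (.leaf 4)) (.splitA (.leaf 0) (.leaf 5))) (.splitB (.splitA
    (.leaf 4) (.leaf 7)) (.splitA (.leaf 5) (.leaf 7))))
    (t2p := .splitA (.splitB (.splitA (.leaf 2) (.leaf 5)) (.splitA (.leaf 2) (.leaf 6))) (.splitB (.splitA
    (.leaf 5) (.leaf 8)) (.splitA (.leaf 6) (.leaf 8))))
    (t2m := .splitA (.splitB (.splitA (.leaf 1) (.leaf 4)) (.splitA (.leaf 1) (.splitB (.leaf 1) (.leaf 10))))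
    (.splitB (.splitA (.leaf 4) (.splitB (.leaf 4) (.leaf 10))) (.leaf 10)))
    (by decide +kernel)
end Summit.Ventures.Crystal3D.Theorems

end
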